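/-
Copyright: the b2b-balaban cell (near-miss cell 7), T⁴-continuum CRUX team (coordinator ruling e34b3e0c item (2)),
seat t4-ne7b-formalise-leaf-06 (gen 29). Released under the licence of the surrounding project.
-/
import Summits.QuantumFields.BalabanUV.T4Continuum.Spine.NE7b.EnergyDichotomySU2
import Summits.QuantumFields.BalabanUV.T4Continuum.Spine.NE7b.SU2EulerLagrangeBridge

/-!
# (L1) for `SU(2)` configurations with ALL HYPOTHESES ON THE `SU(2)` SIDE: hole links minimising the Wilson action
# (route NE7b R-H; referee `t4/formal/NE7b/REFEREE.md` pass 49 OI-61, consumer end)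

Cell `pub-balaban`, sub-cell `t4`, spine estimate NE7b (node U5c). `EnergyDichotomySU2.dichotomy_su2_dist1` (p258376) states
the energy dichotomy (L1) for `U : ZdGaugeConfig 4 SU(2)` with the small-field hypotheses in the cell's `dist1` vocabulary but
the criticality hypothesis `hcrit` on the quaternion side (`covDiv (toSphereConfig U) … = 0`). With the bridge
`SU2EulerLagrangeBridge` (p259864) the criticality hypothesis is now stated on the `SU(2)` side too, in the form route R-H's
references carry it — the hole's links are (local or global) one-link MINIMISERS of the `SU(2)` Wilson action
`actionThroughSU2` (the action of a minimiser over the hole's free links, exterior frozen, is in particular minimal in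
each free link separately):

* **`dichotomy_su2_dist1_of_isLocalMin`** — every link `(x,i)`, `(x + e_j, i)` of a hole plaquette is a LOCAL minimiser,
  on the topological group `SU(2)`, of `V ↦ actionThroughSU2 (U with that link := V)`; `dist1 (U(∂p)) ≤ ½` on the hole,
  `≤ b ≤ 1` elsewhere ⟹ EITHER `‖E_{ij}(x)‖ ≤ (1+η)·b` on the hole OR `Σ_{x∈I} max_{ij}‖E_{ij}(x)‖² ≥ η⁴∕((1+η)⁴·4·464²)`;
* **`dichotomy_su2_dist1_of_forall_le`** — the same from GLOBAL one-link minimality (no value of the link lowers the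
  action through it);
* **`dichotomy_su2_dist1_of_isHermitian`** — the same from the matrix Yang–Mills equation `(U_b·S_b)ᴴ = U_b·S_b` at those
  links (`S_b = stapleSU2 U …`).

HONEST FRAMING. Corollaries by composition (`dichotomy_su2_dist1` ∘ `covDiv_toSphereConfig_eq_zero_of_isLocalMin` ∕
`_of_forall_actionThroughSU2_le` ∕ `_iff_isHermitian`); law-free facts about ONE configuration; nothing of (JC), (S-E),
(MP<L²)'s clauses, H1–H3 or of [Bałaban 1983–89] asserted or cited. NE7b (`T4WeightBudget.RelWeightBound`) NOT PRINTED and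
NOT PROVED; spine PROVED 0∕9; rung (B)+1 on a FINITE torus T⁴ — NOT infinite volume, NOT the mass gap, NOT Clay. HONEST
DEPENDENCY: continuum YM on T⁴ ⇐ BetaPertH ∧ nine spine estimates (0/9 proved); BetaPertH ⇐ (D1) ∧ (D4) ∧ CAP+tail; G-an2-4
gates asym, D1 and NE2/3/4. POLICY: crux-route work under `Spine/NE7b/`; 0 definitions, no `Prop`-valued fact, no `[cite:]`.
-/

set_option autoImplicit false

noncomputable section

namespace Summit.QuantumFields.BalabanUV.T4Continuum.NE7b.EnergyDichotomySU2Minimiser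

open Finset
open scoped BigOperators Quaternion Matrix
open Literature.MathematicalPhysics.QuantumFieldTheory (ZdGaugeConfig)
open Literature.MathematicalPhysics.QuantumFieldTheory.Balaban1983to89 (dist1)
open Literature.Probability.LatticeModels (Site)
open Summit.QuantumFields.BalabanUV.T4Continuum.NE7b.AbelianCurvatureMaximumPrinciple (e)
open Summit.QuantumFields.BalabanUV.T4Continuum.NE7b.CovariantDivergenceEL (curv covDiv)
open Summit.QuantumFields.BalabanUV.T4Continuum.NE7b.EnergyDichotomy (siteCurv)
open Summit.QuantumFields.BalabanUV.T4Continuum.NE7b.EnergyDichotomySU2 (dichotomy_su2_dist1)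
open Summit.QuantumFields.BalabanUV.T4Continuum.NE7b.SU2QuaternionBridge (toSphereConfig)
open Summit.QuantumFields.BalabanUV.T4Continuum.NE7b.SU2EulerLagrangeBridge
  (stapleSU2 actionThroughSU2 covDiv_toSphereConfig_eq_zero_of_isLocalMin
    covDiv_toSphereConfig_eq_zero_of_forall_actionThroughSU2_le covDiv_toSphereConfig_eq_zero_iff_isHermitian)

/-- **(L1) FOR `SU(2)` CONFIGURATIONS, LOCAL-MINIMISER FORM.** `U : ZdGaugeConfig 4 SU(2)`, `I` a finite hole, `0 ≤ b ≤ 1`,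
`η > 0`; every link `(x,i)` and `(x + e_j, i)` (`x ∈ I`, `i ≠ j`) is a LOCAL minimiser on `SU(2)` of the Wilson action of the
plaquettes through it, the other links frozen; `dist1 (U(∂p)) ≤ ½` for hole plaquettes and `≤ b` for all others. Then EITHER
`‖E_{ij}(x)‖ ≤ (1+η)·b` on the hole OR `Σ_{x∈I} max_{ij}‖E_{ij}(x)‖² ≥ η⁴∕((1+η)⁴·4·464²)` (`E` the sine-curvature of the
transported configuration, `‖E_p‖² = 1 − (½ Re tr U_p)²` by `SU2QuaternionBridge.norm_curv_sq_eq`). -/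
theorem dichotomy_su2_dist1_of_isLocalMin (U : ZdGaugeConfig 4 (Matrix.specialUnitaryGroup (Fin 2) ℂ))
    (I : Finset (Site 4)) {b η : ℝ} (hb : 0 ≤ b) (hb1 : b ≤ 1) (hη : 0 < η)
    (hmin : ∀ x ∈ I, ∀ i j : Fin 4, i ≠ j →
      IsLocalMin (fun V : Matrix.specialUnitaryGroup (Fin 2) ℂ => actionThroughSU2 (Function.update U (x, i) V) x i)
          (U (x, i)) ∧
        IsLocalMin (fun V : Matrix.specialUnitaryGroup (Fin 2) ℂ =>
          actionThroughSU2 (Function.update U (x + e j, i) V) (x + e j) i) (U (x + e j, i)))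
    (hhole : ∀ x ∈ I, ∀ i j : Fin 4, dist1 (ZdGaugeConfig.plaquette U x i j) ≤ 1 / 2)
    (hout : ∀ y ∉ I, ∀ i j : Fin 4, dist1 (ZdGaugeConfig.plaquette U y i j) ≤ b) :
    (∀ x ∈ I, ∀ i j : Fin 4, ‖curv (toSphereConfig U) x i j‖ ≤ (1 + η) * b)
      ∨ η ^ 4 / ((1 + η) ^ 4 * 4 * 464 ^ 2) ≤ ∑ x ∈ I, siteCurv (toSphereConfig U) x ^ 2 :=
  dichotomy_su2_dist1 U I hb hb1 hη
    (fun x hx i j hij => ⟨covDiv_toSphereConfig_eq_zero_of_isLocalMin U x i (hmin x hx i j hij).1,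
      covDiv_toSphereConfig_eq_zero_of_isLocalMin U (x + e j) i (hmin x hx i j hij).2⟩) hhole hout

/-- **(L1) FOR `SU(2)` CONFIGURATIONS, GLOBAL-MINIMISER FORM**: the same conclusion when no value `V ∈ SU(2)` of any of those
links lowers the Wilson action through the link (in particular when `U` minimises the `SU(2)` Wilson action over a set of free
links containing them, the rest frozen — route R-H's references). -/
theorem dichotomy_su2_dist1_of_forall_le (U : ZdGaugeConfig 4 (Matrix.specialUnitaryGroup (Fin 2) ℂ))
    (I : Finset (Site 4)) {b η : ℝ} (hb : 0 ≤ b) (hb1 : b ≤ 1) (hη : 0 < η)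
    (hmin : ∀ x ∈ I, ∀ i j : Fin 4, i ≠ j →
      (∀ V : Matrix.specialUnitaryGroup (Fin 2) ℂ,
          actionThroughSU2 U x i ≤ actionThroughSU2 (Function.update U (x, i) V) x i) ∧
        ∀ V : Matrix.specialUnitaryGroup (Fin 2) ℂ,
          actionThroughSU2 U (x + e j) i ≤ actionThroughSU2 (Function.update U (x + e j, i) V) (x + e j) i)
    (hhole : ∀ x ∈ I, ∀ i j : Fin 4, dist1 (ZdGaugeConfig.plaquette U x i j) ≤ 1 / 2)
    (hout : ∀ y ∉ I, ∀ i j : Fin 4, dist1 (ZdGaugeConfig.plaquette U y i j) ≤ b) :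
    (∀ x ∈ I, ∀ i j : Fin 4, ‖curv (toSphereConfig U) x i j‖ ≤ (1 + η) * b)
      ∨ η ^ 4 / ((1 + η) ^ 4 * 4 * 464 ^ 2) ≤ ∑ x ∈ I, siteCurv (toSphereConfig U) x ^ 2 :=
  dichotomy_su2_dist1 U I hb hb1 hη
    (fun x hx i j hij => ⟨covDiv_toSphereConfig_eq_zero_of_forall_actionThroughSU2_le U x i (hmin x hx i j hij).1,
      covDiv_toSphereConfig_eq_zero_of_forall_actionThroughSU2_le U (x + e j) i (hmin x hx i j hij).2⟩) hhole hout

/-- **(L1) FOR `SU(2)` CONFIGURATIONS, MATRIX-EQUATION FORM**: the same conclusion when those links satisfy the lattice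
Yang–Mills equation in `SU(2)` matrix form, `(U_b·S_b)ᴴ = U_b·S_b` with `S_b = stapleSU2 U …`. -/
theorem dichotomy_su2_dist1_of_isHermitian (U : ZdGaugeConfig 4 (Matrix.specialUnitaryGroup (Fin 2) ℂ))
    (I : Finset (Site 4)) {b η : ℝ} (hb : 0 ≤ b) (hb1 : b ≤ 1) (hη : 0 < η)
    (hym : ∀ x ∈ I, ∀ i j : Fin 4, i ≠ j →
      (((U (x, i) : Matrix.specialUnitaryGroup (Fin 2) ℂ) : Matrix (Fin 2) (Fin 2) ℂ) * stapleSU2 U x i).IsHermitian ∧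
        (((U (x + e j, i) : Matrix.specialUnitaryGroup (Fin 2) ℂ) : Matrix (Fin 2) (Fin 2) ℂ) *
          stapleSU2 U (x + e j) i).IsHermitian)
    (hhole : ∀ x ∈ I, ∀ i j : Fin 4, dist1 (ZdGaugeConfig.plaquette U x i j) ≤ 1 / 2)
    (hout : ∀ y ∉ I, ∀ i j : Fin 4, dist1 (ZdGaugeConfig.plaquette U y i j) ≤ b) :
    (∀ x ∈ I, ∀ i j : Fin 4, ‖curv (toSphereConfig U) x i j‖ ≤ (1 + η) * b)
      ∨ η ^ 4 / ((1 + η) ^ 4 * 4 * 464 ^ 2) ≤ ∑ x ∈ I, siteCurv (toSphereConfig U) x ^ 2 :=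
  dichotomy_su2_dist1 U I hb hb1 hη
    (fun x hx i j hij => ⟨(covDiv_toSphereConfig_eq_zero_iff_isHermitian U x i).2 (hym x hx i j hij).1,
      (covDiv_toSphereConfig_eq_zero_iff_isHermitian U (x + e j) i).2 (hym x hx i j hij).2⟩) hhole hout

end Summit.QuantumFields.BalabanUV.T4Continuum.NE7b.EnergyDichotomySU2Minimiser

end
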